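import Literature.Analysis.FluidPDE.NSRegFourierBootstrap
import Literature.Analysis.FluidPDE.NSRegFourierSynthesis
import Literature.Analysis.FluidPDE.NSFourierSolution
import Literature.Analysis.FluidPDE.ClassicalSolutionCalculus
import HarnessLib

/-!
# The classical solution of the Leray-regularised Navier–Stokes system from its Fourier side

Ninth file of the Fourier-side construction of the global regular solution of the
Leray-regularised Navier–Stokes system (discharge of
`Literature.Analysis.FluidPDE.leray_regularised_wellposed`). Given a regularised mild solution
`V` of every weight on `[0, T]` (`IsRegMildAll (4π²ν) m T V`, `NSRegFourierBootstrap`), the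
synthesized fields

  `u(t, x) = Re 𝓕(V(t))(x)`, `Ju(t, x) = Re 𝓕(m • V(t))(x)`, `p(t, x) = Re 𝓕(q(t))(x)`,
  `q(t) = presSymbol (m • V(t)) (V(t))`,

are jointly `C^∞` on `[0, T] × E`, `u(t)` and `Ju(t)` are divergence free, and
**`∂ₜu + (Ju·∇)u = νΔu − ∇p`** holds pointwise on `[0, T] × E` — Leray's regularised system
(Leray 1934, (5.1) p. 237 with the mollified transport velocity `\overline{U}`), here derived
exactly as in `NSFourierSolution` (derivative dictionary under square domination, convolution
theorem, and the pointwise identity `G − N − 2πi ξ q = 0`). Packaged for the tree's classical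
calculus: `(u, p)` is an `IsClassicalNSSolutionOn (Icc 0 T) ν f u p` with the smooth
"fictitious force" `f = (u·∇)u − (Ju·∇)u` (`RegSetup.isClassicalNSSolutionOn`).

## Tree search

The two moment-hypothesis dictionary lemmas `fderiv_fourier_apply_mom` and `laplacian_fourier_mom`
below have twins `FourierNS.fderiv_fourier_apply_of_integrable` / `FourierNS.laplacian_fourier_of_moments`
in `TaoH1FourierMildSolution` (landed in parallel, for Tao's `H¹` mild solutions); that file is not
imported because its Literature import closure (the `H¹` theory, enstrophy persistence,
unconditional uniqueness, …) would add 28 files to the 45 of this one. A librarian may hoist the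
pair into `NSFourierDictionary` and make both files use it.

## References

* J. Leray, Acta Math. 63 (1934), §8 Lemme 9, §19, Ch. V §26 (5.1). [Leray1934]
* W. S. Ożański, B. C. Pooley, LMS Lecture Note Ser. 452 (2018), §6.3, Thm. 6.33. [OzanskiPooley2018]
* P. G. Lemarié-Rieusset, *The Navier–Stokes problem in the 21st century* (2016), §6.1, §7.3.
-/

noncomputable section

open MeasureTheory Real Set Filter Topology Function Complex FourierTransform VectorFourier
  InnerProductSpace
open scoped FourierTransform RealInnerProductSpace ENNReal ContDiff ComplexConjugate Laplacian

namespace Literature.Analysis.FluidPDE.FourierNS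

open ClayDatum (reVec reVec_apply inner_eq_sum')

variable {ι : Type*} [Fintype ι]

/-! ### The derivative dictionary under moment hypotheses -/

section Dictionary

variable {f : EuclideanSpace ℝ ι → ℂ}

/-- `∂_h 𝓕 f = 𝓕 (-2πi⟪ξ, h⟫ f)` for integrable `f` with integrable first moment. Twin of
`fderiv_fourier_apply_of_integrable` (`TaoH1FourierMildSolution`, not imported: see the header). [folklore] -/
theorem fderiv_fourier_apply_mom (hint : Integrable f) (hint1 : Integrable fun ξ : EuclideanSpace ℝ ι => ‖ξ‖ * ‖f ξ‖)
    (x h : EuclideanSpace ℝ ι) :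
    fderiv ℝ (𝓕 f) x h = 𝓕 (fun ξ => (-(2 * π * I) * (⟪ξ, h⟫ : ℂ)) * f ξ) x := by
  rw [Real.fderiv_fourier hint hint1, Real.fourier_continuousLinearMap_apply (integrable_fourierSMulRight' hint hint1)]
  have hfun : (fun ξ : EuclideanSpace ℝ ι => fourierSMulRight (innerSL ℝ) f ξ h) =
      fun ξ : EuclideanSpace ℝ ι => (-(2 * π * I) * (⟪ξ, h⟫ : ℂ)) * f ξ := by
    funext ξ
    change -(2 * π * I) • ((⟪ξ, h⟫ : ℝ) • f ξ) = _
    rw [Complex.real_smul, smul_eq_mul]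
    ring
  rw [hfun]

/-- `Δ 𝓕 f = 𝓕 (-4π²‖ξ‖² f)` for `f` with integrable moments up to order `2`. Twin of
`laplacian_fourier_of_moments` (`TaoH1FourierMildSolution`, not imported: see the header). [folklore] -/
theorem laplacian_fourier_mom (hfm : AEStronglyMeasurable f volume)
    (hmom : ∀ m ≤ 2, Integrable fun ξ : EuclideanSpace ℝ ι => ‖ξ‖ ^ m * ‖f ξ‖) (x : EuclideanSpace ℝ ι) :
    (Δ (𝓕 f)) x = 𝓕 (fun ξ => (-(4 * π ^ 2 * ‖ξ‖ ^ 2 : ℝ) : ℂ) * f ξ) x := by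
  classical
  rw [laplacian_eq_iteratedFDeriv_orthonormalBasis (𝓕 f) (EuclideanSpace.basisFun ι ℝ)]
  simp only
  rw [Real.iteratedFDeriv_fourier (N := (2 : ℕ)) (fun m hm => hmom m (mod_cast hm)) hfm (n := 2) (mod_cast le_rfl)]
  have hI : Integrable fun ξ => fourierPowSMulRight (innerSL ℝ) f ξ 2 :=
    integrable_fourierPowSMulRight _ (hmom 2 le_rfl) hfm
  set g : ι → EuclideanSpace ℝ ι → ℂ := fun i ξ => ((-(2 * π * I)) ^ 2 * ((ξ i : ℝ) : ℂ) ^ 2) * f ξ with hg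
  have hterm : ∀ i : ι, 𝓕 (fun ξ => fourierPowSMulRight (innerSL ℝ) f ξ 2) x
      ![(EuclideanSpace.basisFun ι ℝ) i, (EuclideanSpace.basisFun ι ℝ) i] = 𝓕 (g i) x := by
    intro i
    rw [Real.fourier_continuousMultilinearMap_apply hI]
    have hfun : (fun ξ : EuclideanSpace ℝ ι => fourierPowSMulRight (innerSL ℝ) f ξ 2
        ![(EuclideanSpace.basisFun ι ℝ) i, (EuclideanSpace.basisFun ι ℝ) i]) = g i := by
      funext ξ
      rw [fourierPowSMulRight_apply, Fin.prod_univ_two]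
      simp only [Matrix.cons_val_zero, Matrix.cons_val_one]
      rw [EuclideanSpace.basisFun_apply]
      change (-(2 * π * I)) ^ 2 • ((⟪ξ, EuclideanSpace.single i (1 : ℝ)⟫ *
        ⟪ξ, EuclideanSpace.single i (1 : ℝ)⟫ : ℝ) • f ξ) = g i ξ
      rw [EuclideanSpace.inner_single_right, Complex.real_smul, smul_eq_mul]
      simp only [hg, conj_trivial, one_mul, Complex.ofReal_mul]
      ring
    rw [hfun]
  simp_rw [hterm]
  have hfi : ∀ i ∈ (Finset.univ : Finset ι), Integrable (g i) := by
    intro i _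
    have h2 := hmom 2 le_rfl
    refine (h2.const_mul (4 * π ^ 2)).mono' ?_ (Eventually.of_forall fun ξ => ?_)
    · exact ((Continuous.aestronglyMeasurable (by fun_prop)).mul hfm)
    · simp only [hg]
      rw [norm_mul, norm_mul, norm_pow, norm_neg, norm_mul, norm_mul, Complex.norm_two,
        Complex.norm_real, Complex.norm_I, mul_one, Real.norm_eq_abs, abs_of_pos Real.pi_pos,
        norm_pow, Complex.norm_real, Real.norm_eq_abs]
      have h1 : |ξ i| ^ 2 ≤ ‖ξ‖ ^ 2 := pow_le_pow_left₀ (abs_nonneg _) (abs_apply_le_norm ξ i) 2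
      calc (2 * π) ^ 2 * |ξ i| ^ 2 * ‖f ξ‖ ≤ (2 * π) ^ 2 * ‖ξ‖ ^ 2 * ‖f ξ‖ := by gcongr
        _ = 4 * π ^ 2 * (‖ξ‖ ^ 2 * ‖f ξ‖) := by ring
  rw [← fourier_finset_sum' Finset.univ hfi]
  have hsum : (fun ξ : EuclideanSpace ℝ ι => ∑ b, g b ξ) = fun ξ => (-(4 * π ^ 2 * ‖ξ‖ ^ 2 : ℝ) : ℂ) * f ξ := by
    funext ξ
    change ∑ b, ((-(2 * π * I)) ^ 2 * ((ξ b : ℝ) : ℂ) ^ 2) * f ξ = _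
    rw [← Finset.sum_mul]
    congr 1
    have hI2 : (-(2 * (π : ℂ) * I)) ^ 2 = -(4 * π ^ 2) := by
      rw [neg_sq, mul_pow, mul_pow, Complex.I_sq]; ring
    simp only [hI2]
    rw [← Finset.mul_sum, show (∑ i, ((ξ i : ℝ) : ℂ) ^ 2) = ((∑ i, (ξ i) ^ 2 : ℝ) : ℂ) by
      push_cast; rfl, sum_sq_eq_norm_sq]
    push_cast
    ring
  rw [hsum]

/-- Integrability of `-2πi ξ_l W` for components with a first moment. [folklore] -/
theorem integrable_twoPiI_coord_mul {W : EuclideanSpace ℝ ι → ℂ} (hW : AEStronglyMeasurable W volume)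
    (h1 : Integrable (fun ξ : EuclideanSpace ℝ ι => ‖ξ‖ ^ 1 * ‖W ξ‖) volume) (l : ι) :
    Integrable (fun ξ : EuclideanSpace ℝ ι => (-(2 * π * I) * ((ξ l : ℝ) : ℂ)) * W ξ) volume := by
  refine (h1.const_mul (2 * π)).mono' ((Continuous.aestronglyMeasurable (by fun_prop)).mul hW)
    (Eventually.of_forall fun ξ => ?_)
  rw [norm_mul, norm_mul, norm_neg, norm_mul, norm_mul, Complex.norm_two, Complex.norm_real, Complex.norm_I, mul_one,
    Real.norm_eq_abs, abs_of_pos Real.pi_pos, Complex.norm_real, Real.norm_eq_abs, pow_one]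
  calc 2 * π * |ξ l| * ‖W ξ‖ ≤ 2 * π * ‖ξ‖ * ‖W ξ‖ := by gcongr; exact abs_apply_le_norm ξ l
    _ = 2 * π * (‖ξ‖ * ‖W ξ‖) := by ring

end Dictionary

/-! ### The setup -/

variable [DecidableEq ι]

/-- **Regularised setup**: viscosity `ν > 0`, a mollifier symbol `m`, a time `T > 0` and a
coefficient field `V` which is a regularised mild solution of every weight on `[0, T]` for the
heat rate `c = 4π²ν`. [folklore] -/
structure RegSetup (ι : Type*) [Fintype ι] [DecidableEq ι] where
  /-- viscosity -/
  ν : ℝ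
  /-- positivity of the viscosity -/
  hν : 0 < ν
  /-- the mollifier multiplier -/
  m : EuclideanSpace ℝ ι → ℝ
  /-- the final time -/
  T : ℝ
  /-- positivity of the final time -/
  hT : 0 < T
  /-- the Fourier coefficient field -/
  V : ℝ → EuclideanSpace ℝ ι → ι → ℂ
  /-- `V` is a regularised mild solution of every weight on `[0, T]` -/
  mild : IsRegMildAll (4 * π ^ 2 * ν) m T V

namespace RegSetup

variable (d : RegSetup ι)

/-- The heat rate `c = 4π²ν`. [folklore] -/
def c : ℝ := 4 * π ^ 2 * d.ν

/-- `c > 0`. [folklore] -/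
theorem c_pos : 0 < d.c := by unfold c; have := d.hν; positivity

/-- The weight-`K` mildness. [folklore] -/
theorem mildK (K : ℕ) : IsRegMild d.c d.m K 0 d.T d.V := d.mild K

/-- The multiplier is a mollifier symbol. [folklore] -/
theorem hm : IsMollifierSymbol d.m := (d.mildK 0).hm

/-- Measurable slices. [folklore] -/
theorem measurable_V (t : ℝ) : Measurable (d.V t) := (d.mildK 0).measurable_slice' t

/-- Measurable components. [folklore] -/
theorem aesm_V (t : ℝ) (l : ι) : AEStronglyMeasurable (fun ξ => d.V t ξ l) volume :=
  (measurable_pi_iff.1 (d.measurable_V t) l).aestronglyMeasurable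

/-- Measurable multiplied components. [folklore] -/
theorem aesm_mV (t : ℝ) (l : ι) : AEStronglyMeasurable (fun ξ => (d.m ξ : ℂ) * d.V t ξ l) volume :=
  d.hm.measurable.complex_ofReal.aestronglyMeasurable.mul (d.aesm_V t l)

/-- **Integrable weighted slices**: `(1 + ‖ξ‖)^K ‖V(t,ξ)‖ ∈ L¹` for `t ∈ [0, T]`, every `K`. [folklore] -/
theorem integrable_weight_mul_norm (K : ℕ) {t : ℝ} (ht : t ∈ Icc 0 d.T) :
    Integrable (fun ξ : EuclideanSpace ℝ ι => (1 + ‖ξ‖) ^ K * ‖d.V t ξ‖) volume := by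
  set K₀ := Fintype.card ι + 1
  obtain ⟨G, hG, hle⟩ := d.mild.dom_weight (K + K₀)
  have hw : MemLp (fun ξ : EuclideanSpace ℝ ι => ((1 + ‖ξ‖) ^ K₀)⁻¹) 2 volume := memLp_inv_one_add_norm_pow_two
  refine (hG.integrable_mul hw).mono' ?_ (Eventually.of_forall fun ξ => ?_)
  · exact (((by fun_prop : Continuous fun ξ : EuclideanSpace ℝ ι => (1 + ‖ξ‖) ^ K).measurable).mul
      (d.measurable_V t).norm).aestronglyMeasurable
  · rw [Real.norm_of_nonneg (by positivity)]
    have hpos : 0 < (1 + ‖ξ‖) ^ K₀ := by positivity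
    change (1 + ‖ξ‖) ^ K * ‖d.V t ξ‖ ≤ G ξ * ((1 + ‖ξ‖) ^ K₀)⁻¹
    rw [le_mul_inv_iff₀ hpos]
    calc (1 + ‖ξ‖) ^ K * ‖d.V t ξ‖ * (1 + ‖ξ‖) ^ K₀ = (1 + ‖ξ‖) ^ (K + K₀) * ‖d.V t ξ‖ := by rw [pow_add]; ring
      _ ≤ G ξ := hle t ht ξ

/-- Integrable moments of the components: `‖ξ‖^k ‖V(t,ξ)ₗ‖ ∈ L¹`, `t ∈ [0, T]`. [folklore] -/
theorem integrable_pow_mul_norm (k : ℕ) {t : ℝ} (ht : t ∈ Icc 0 d.T) (l : ι) :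
    Integrable (fun ξ : EuclideanSpace ℝ ι => ‖ξ‖ ^ k * ‖d.V t ξ l‖) volume := by
  refine (d.integrable_weight_mul_norm k ht).mono' ((continuous_norm.measurable.pow_const k).mul
    (measurable_pi_iff.1 (d.measurable_V t) l).norm).aestronglyMeasurable (Eventually.of_forall fun ξ => ?_)
  rw [Real.norm_of_nonneg (by positivity)]
  refine mul_le_mul (pow_le_pow_left₀ (norm_nonneg _) (by linarith [norm_nonneg ξ]) k) (norm_le_pi_norm _ l)
    (norm_nonneg _) (by positivity)

/-- Integrable moments of the multiplied components: `‖ξ‖^k ‖m(ξ) V(t,ξ)ₗ‖ ∈ L¹`. [folklore] -/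
theorem integrable_pow_mul_norm_mV (k : ℕ) {t : ℝ} (ht : t ∈ Icc 0 d.T) (l : ι) :
    Integrable (fun ξ : EuclideanSpace ℝ ι => ‖ξ‖ ^ k * ‖(d.m ξ : ℂ) * d.V t ξ l‖) volume := by
  refine (d.integrable_pow_mul_norm k ht l).mono' ((continuous_norm.measurable.pow_const k).mul
    (d.hm.measurable.complex_ofReal.mul (measurable_pi_iff.1 (d.measurable_V t) l)).norm).aestronglyMeasurable
    (Eventually.of_forall fun ξ => ?_)
  rw [Real.norm_of_nonneg (by positivity), norm_mul, Complex.norm_real, Real.norm_eq_abs]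
  calc ‖ξ‖ ^ k * (|d.m ξ| * ‖d.V t ξ l‖) ≤ ‖ξ‖ ^ k * (1 * ‖d.V t ξ l‖) := by gcongr; exact d.hm.abs_le_one ξ
    _ = ‖ξ‖ ^ k * ‖d.V t ξ l‖ := by rw [one_mul]

/-- Integrable components. [folklore] -/
theorem integrable_V {t : ℝ} (ht : t ∈ Icc 0 d.T) (l : ι) : Integrable (fun ξ => d.V t ξ l) volume := by
  have := d.integrable_pow_mul_norm 0 ht l
  simp only [pow_zero, one_mul] at this
  exact this.mono' (d.aesm_V t l) (Eventually.of_forall fun ξ => le_rfl)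

/-- Integrable multiplied components. [folklore] -/
theorem integrable_mV {t : ℝ} (ht : t ∈ Icc 0 d.T) (l : ι) : Integrable (fun ξ => (d.m ξ : ℂ) * d.V t ξ l) volume := by
  have := d.integrable_pow_mul_norm_mV 0 ht l
  simp only [pow_zero, one_mul] at this
  exact this.mono' (d.aesm_mV t l) (Eventually.of_forall fun ξ => le_rfl)

/-! ### The synthesized fields -/

/-- The complex velocity component `U(t, x)_l = 𝓕 (V(t)ₗ)(x)`. [folklore] -/
def U (t : ℝ) (x : EuclideanSpace ℝ ι) (l : ι) : ℂ := 𝓕 (fun ξ => d.V t ξ l) x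

/-- **The velocity field** `u(t, x) = Re U(t, x)`. [folklore] -/
def u (t : ℝ) (x : EuclideanSpace ℝ ι) : EuclideanSpace ℝ ι := reVec (d.U t x)

/-- The complex mollified velocity component `JU(t, x)_l = 𝓕 (m V(t)ₗ)(x)`. [folklore] -/
def JU (t : ℝ) (x : EuclideanSpace ℝ ι) (l : ι) : ℂ := 𝓕 (fun ξ => (d.m ξ : ℂ) * d.V t ξ l) x

/-- **The mollified (transport) velocity** `Ju(t, x) = Re JU(t, x)` (Leray's `\overline{U}`). [folklore] -/
def ju (t : ℝ) (x : EuclideanSpace ℝ ι) : EuclideanSpace ℝ ι := reVec (d.JU t x)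

/-- The pressure symbol `q(t) = presSymbol (m • V(t)) (V(t))`. [folklore] -/
def q (t : ℝ) (ξ : EuclideanSpace ℝ ι) : ℂ := presSymbol (vmul d.m (d.V t)) (d.V t) ξ

/-- The complex pressure `P(t, x) = 𝓕 (q t) x`. [folklore] -/
def P (t : ℝ) (x : EuclideanSpace ℝ ι) : ℂ := 𝓕 (d.q t) x

/-- **The pressure** `p(t, x) = Re P(t, x)`. [folklore] -/
def p (t : ℝ) (x : EuclideanSpace ℝ ι) : ℝ := (d.P t x).re

/-- Components of `u`. [folklore] -/
@[simp]
theorem u_apply (t : ℝ) (x : EuclideanSpace ℝ ι) (l : ι) : d.u t x l = (d.U t x l).re := rfl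

/-- Components of `Ju`. [folklore] -/
@[simp]
theorem ju_apply (t : ℝ) (x : EuclideanSpace ℝ ι) (l : ι) : d.ju t x l = (d.JU t x l).re := rfl

/-- Conjugation symmetry of the components. [folklore] -/
theorem V_conj (t : ℝ) (ξ : EuclideanSpace ℝ ι) (l : ι) : d.V t (-ξ) l = conj (d.V t ξ l) := (d.mildK 0).conjSymm t ξ l

/-- Conjugation symmetry of the multiplied components (`m` is even and real). [folklore] -/
theorem mV_conj (t : ℝ) (ξ : EuclideanSpace ℝ ι) (l : ι) :
    (d.m (-ξ) : ℂ) * d.V t (-ξ) l = conj ((d.m ξ : ℂ) * d.V t ξ l) := by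
  rw [map_mul, Complex.conj_ofReal, d.hm.even, d.V_conj]

/-- Transversality. [folklore] -/
theorem sum_mul_V (t : ℝ) (ξ : EuclideanSpace ℝ ι) : ∑ l, (ξ l : ℂ) * d.V t ξ l = 0 := (d.mildK 0).divFree t ξ

/-- **Reality**: `(u(t,x)_l : ℂ) = U(t,x)_l`. [folklore] -/
theorem ofReal_u_apply (t : ℝ) (x : EuclideanSpace ℝ ι) (l : ι) : ((d.u t x l : ℝ) : ℂ) = d.U t x l := by
  rw [u_apply, U]
  exact (fourier_eq_re_of_conj_symm (fun ξ => d.V_conj t ξ l) x).symm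

/-- **Reality of the mollified velocity**: `(Ju(t,x)_l : ℂ) = JU(t,x)_l`. [folklore] -/
theorem ofReal_ju_apply (t : ℝ) (x : EuclideanSpace ℝ ι) (l : ι) : ((d.ju t x l : ℝ) : ℂ) = d.JU t x l := by
  rw [ju_apply, JU]
  exact (fourier_eq_re_of_conj_symm (fun ξ => d.mV_conj t ξ l) x).symm

/-! ### Smoothness on the closed slab -/

/-- Square-dominated families of all orders. [folklore] -/
theorem exists_family (n : ℕ) : ∃ W : ℕ → ℝ → EuclideanSpace ℝ ι → ι → ℂ, W 0 = d.V ∧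
    ∀ l, IsDomFamily d.T n (fun k t ξ => W k t ξ l) := d.mild.exists_domFamily d.hT n

/-- **The velocity is jointly smooth on `[0, T] × E`.** [folklore] -/
theorem smooth_u : IsSmoothSpaceTimeOn (Icc 0 d.T) d.u := by
  unfold IsSmoothSpaceTimeOn
  refine (contDiffOn_euclidean (ι := ι) (𝕜 := ℝ)).2 fun l => ?_
  have h : ContDiffOn ℝ ∞ (fun z : ℝ × EuclideanSpace ℝ ι => 𝓕 (fun ξ => d.V z.1 ξ l) z.2) (Icc 0 d.T ×ˢ univ) := by
    refine contDiffOn_synth_infty_dom (W₀ := fun t ξ => d.V t ξ l) d.hT fun n => ?_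
    obtain ⟨W, hW0, hW⟩ := d.exists_family n
    exact ⟨fun k t ξ => W k t ξ l, by funext t ξ; simp only [hW0], hW l⟩
  exact Complex.reCLM.contDiff.comp_contDiffOn h

/-- **The mollified velocity is jointly smooth on `[0, T] × E`.** [folklore] -/
theorem smooth_ju : IsSmoothSpaceTimeOn (Icc 0 d.T) d.ju := by
  unfold IsSmoothSpaceTimeOn
  refine (contDiffOn_euclidean (ι := ι) (𝕜 := ℝ)).2 fun l => ?_
  have h : ContDiffOn ℝ ∞ (fun z : ℝ × EuclideanSpace ℝ ι => 𝓕 (fun ξ => (d.m ξ : ℂ) * d.V z.1 ξ l) z.2)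
      (Icc 0 d.T ×ˢ univ) := by
    refine contDiffOn_synth_infty_dom (W₀ := fun t ξ => (d.m ξ : ℂ) * d.V t ξ l) d.hT fun n => ?_
    obtain ⟨W, hW0, hW⟩ := d.exists_family n
    exact ⟨fun k t ξ => vmul d.m (W k t) ξ l, by funext t ξ; simp only [hW0],
      IsRegMildAll.isDomFamily_vmul d.hm hW l⟩
  exact Complex.reCLM.contDiff.comp_contDiffOn h

/-- The pressure symbol has (pointwise-decaying) families of all orders. [folklore] -/
theorem exists_presFamily (n : ℕ) : ∃ Q : ℕ → ℝ → EuclideanSpace ℝ ι → ℂ,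
    (∀ t ξ, Q 0 t ξ = d.q t ξ) ∧ IsFourierFamily d.T n Q := d.mild.exists_presFamily d.hT n

/-- **The pressure is jointly smooth on `[0, T] × E`.** [folklore] -/
theorem smooth_p : IsSmoothSpaceTimeOn (Icc 0 d.T) d.p := by
  unfold IsSmoothSpaceTimeOn
  have h : ContDiffOn ℝ ∞ (fun z : ℝ × EuclideanSpace ℝ ι => 𝓕 (d.q z.1) z.2) (Icc 0 d.T ×ˢ univ) := by
    refine contDiffOn_synth_infty (W₀ := d.q) d.hT fun n => ?_
    obtain ⟨Q, hQ0, hQ⟩ := d.exists_presFamily n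
    exact ⟨Q, by funext t ξ; exact hQ0 t ξ, hQ⟩
  exact Complex.reCLM.contDiff.comp_contDiffOn h

/-! ### Space derivatives of the velocity -/

section Space

variable {t : ℝ} (ht : t ∈ Icc 0 d.T)
include ht

/-- The `x`-derivative of a complex velocity component: `∂_h U_l = 𝓕 (-2πi⟪ξ,h⟫ V_l)`. [folklore] -/
theorem fderiv_U (x h : EuclideanSpace ℝ ι) (l : ι) :
    fderiv ℝ (fun x => d.U t x l) x h = 𝓕 (fun ξ => (-(2 * π * I) * (⟪ξ, h⟫ : ℂ)) * d.V t ξ l) x :=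
  fderiv_fourier_apply_mom (d.integrable_V ht l) (by simpa using d.integrable_pow_mul_norm 1 ht l) x h

/-- Complex velocity components are differentiable in `x`. [folklore] -/
theorem differentiable_U (l : ι) : Differentiable ℝ (fun x => d.U t x l) :=
  Real.differentiable_fourier (d.integrable_V ht l) (by simpa using d.integrable_pow_mul_norm 1 ht l)

/-- Complex velocity components are `C^n` in `x` for every `n`. [folklore] -/
theorem contDiff_U (l : ι) (n : ℕ) : ContDiff ℝ n (fun x => d.U t x l) :=
  Real.contDiff_fourier fun k _ => d.integrable_pow_mul_norm k ht l

/-- The complex velocity vector is differentiable. [folklore] -/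
theorem differentiableAt_Uvec (x : EuclideanSpace ℝ ι) : DifferentiableAt ℝ (d.U t) x :=
  differentiableAt_pi.2 fun l => (d.differentiable_U ht l) x

/-- The complex velocity vector is `C^n`. [folklore] -/
theorem contDiff_Uvec (n : ℕ) : ContDiff ℝ n (d.U t) := contDiff_pi' fun l => d.contDiff_U ht l n

omit ht in
/-- `u t = reVec ∘ U t`. [folklore] -/
theorem u_eq_comp : d.u t = reVec ∘ d.U t := rfl

/-- **The velocity gradient**: `(Du(t) x h)_l = Re 𝓕 (-2πi⟪ξ,h⟫ V_l)(x)`. [folklore] -/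
theorem fderiv_u_apply (x h : EuclideanSpace ℝ ι) (l : ι) :
    fderiv ℝ (d.u t) x h l = (𝓕 (fun ξ => (-(2 * π * I) * (⟪ξ, h⟫ : ℂ)) * d.V t ξ l) x).re := by
  have h1 : HasFDerivAt (d.u t) ((reVec (ι := ι)).comp (fderiv ℝ (d.U t) x)) x := by
    rw [u_eq_comp]
    exact (reVec (ι := ι)).hasFDerivAt.comp x (d.differentiableAt_Uvec ht x).hasFDerivAt
  rw [h1.fderiv, ContinuousLinearMap.comp_apply, reVec_apply]
  have h2 : fderiv ℝ (d.U t) x = ContinuousLinearMap.pi fun l => fderiv ℝ (fun x => d.U t x l) x := by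
    change fderiv ℝ (fun x l => d.U t x l) x = _
    exact fderiv_pi fun l => (d.differentiable_U ht l) x
  rw [h2, ContinuousLinearMap.pi_apply, d.fderiv_U ht]

/-- **The velocity is divergence free** for `t ∈ [0, T]`. [folklore] -/
theorem isDivFree_u : VectorCalculus.IsDivFree (d.u t) := by
  classical
  intro x
  rw [divergence_eq_sum_inner_fderiv (EuclideanSpace.basisFun ι ℝ)]
  have hterm : ∀ l, ⟪(EuclideanSpace.basisFun ι ℝ) l, fderiv ℝ (d.u t) x ((EuclideanSpace.basisFun ι ℝ) l)⟫ =
      (𝓕 (fun ξ => (-(2 * π * I) * ((ξ l : ℝ) : ℂ)) * d.V t ξ l) x).re := by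
    intro l
    rw [EuclideanSpace.basisFun_apply, EuclideanSpace.inner_single_left, d.fderiv_u_apply ht]
    simp only [conj_trivial, one_mul, EuclideanSpace.inner_single_right]
  simp_rw [hterm]
  rw [← Complex.re_sum]
  have hint : ∀ l ∈ (Finset.univ : Finset ι), Integrable fun ξ : EuclideanSpace ℝ ι =>
      (-(2 * π * I) * ((ξ l : ℝ) : ℂ)) * d.V t ξ l := fun l _ =>
    integrable_twoPiI_coord_mul (d.aesm_V t l) (d.integrable_pow_mul_norm 1 ht l) l
  rw [← fourier_finset_sum' Finset.univ hint]
  have hzero : (fun ξ : EuclideanSpace ℝ ι => ∑ l, (-(2 * π * I) * ((ξ l : ℝ) : ℂ)) * d.V t ξ l) = fun _ => 0 := by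
    funext ξ
    have := d.sum_mul_V t ξ
    calc ∑ l, (-(2 * π * I) * ((ξ l : ℝ) : ℂ)) * d.V t ξ l = -(2 * π * I) * ∑ l, ((ξ l : ℝ) : ℂ) * d.V t ξ l := by
          rw [Finset.mul_sum]; refine Finset.sum_congr rfl fun l _ => ?_; ring
      _ = 0 := by rw [this, mul_zero]
  rw [hzero, fourier_zero', Complex.zero_re]

/-- **The Laplacian of the velocity**: `(Δu(t) x)_l = Re 𝓕 (-4π²‖ξ‖² V_l)(x)`. [folklore] -/
theorem laplacian_u_apply (x : EuclideanSpace ℝ ι) (l : ι) :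
    (Δ (d.u t)) x l = (𝓕 (fun ξ => (-(4 * π ^ 2 * ‖ξ‖ ^ 2 : ℝ) : ℂ) * d.V t ξ l) x).re := by
  have h2 : ContDiffAt ℝ 2 (d.U t) x := (d.contDiff_Uvec ht 2).contDiffAt
  have h1 : (Δ (d.u t)) x = reVec ((Δ (d.U t)) x) := by
    rw [u_eq_comp]
    exact ContDiffAt.laplacian_CLM_comp_left h2
  rw [h1, reVec_apply]
  have h3 : (Δ (d.U t)) x l = (Δ (fun x => d.U t x l)) x := by
    have := ContDiffAt.laplacian_CLM_comp_left (l := ContinuousLinearMap.proj (R := ℝ) l) h2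
    exact this.symm
  rw [h3]
  have h4 : (fun x => d.U t x l) = 𝓕 (fun ξ => d.V t ξ l) := rfl
  rw [h4, laplacian_fourier_mom (d.aesm_V t l) (fun k _ => d.integrable_pow_mul_norm k ht l)]

/-! ### The mollified velocity -/

/-- Complex mollified velocity components are differentiable in `x`. [folklore] -/
theorem differentiable_JU (l : ι) : Differentiable ℝ (fun x => d.JU t x l) :=
  Real.differentiable_fourier (d.integrable_mV ht l) (by simpa using d.integrable_pow_mul_norm_mV 1 ht l)

/-- The `x`-derivative of a complex mollified velocity component. [folklore] -/
theorem fderiv_JU (x h : EuclideanSpace ℝ ι) (l : ι) :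
    fderiv ℝ (fun x => d.JU t x l) x h = 𝓕 (fun ξ => (-(2 * π * I) * (⟪ξ, h⟫ : ℂ)) * ((d.m ξ : ℂ) * d.V t ξ l)) x :=
  fderiv_fourier_apply_mom (d.integrable_mV ht l) (by simpa using d.integrable_pow_mul_norm_mV 1 ht l) x h

/-- **The mollified velocity gradient.** [folklore] -/
theorem fderiv_ju_apply (x h : EuclideanSpace ℝ ι) (l : ι) :
    fderiv ℝ (d.ju t) x h l = (𝓕 (fun ξ => (-(2 * π * I) * (⟪ξ, h⟫ : ℂ)) * ((d.m ξ : ℂ) * d.V t ξ l)) x).re := by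
  have hd : DifferentiableAt ℝ (d.JU t) x := differentiableAt_pi.2 fun l => (d.differentiable_JU ht l) x
  have h1 : HasFDerivAt (d.ju t) ((reVec (ι := ι)).comp (fderiv ℝ (d.JU t) x)) x := by
    rw [show d.ju t = reVec ∘ d.JU t from rfl]
    exact (reVec (ι := ι)).hasFDerivAt.comp x hd.hasFDerivAt
  rw [h1.fderiv, ContinuousLinearMap.comp_apply, reVec_apply]
  have h2 : fderiv ℝ (d.JU t) x = ContinuousLinearMap.pi fun l => fderiv ℝ (fun x => d.JU t x l) x := by
    change fderiv ℝ (fun x l => d.JU t x l) x = _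
    exact fderiv_pi fun l => (d.differentiable_JU ht l) x
  rw [h2, ContinuousLinearMap.pi_apply, d.fderiv_JU ht]

/-- **The mollified velocity is divergence free** for `t ∈ [0, T]`. [folklore] -/
theorem isDivFree_ju : VectorCalculus.IsDivFree (d.ju t) := by
  classical
  intro x
  rw [divergence_eq_sum_inner_fderiv (EuclideanSpace.basisFun ι ℝ)]
  have hterm : ∀ l, ⟪(EuclideanSpace.basisFun ι ℝ) l, fderiv ℝ (d.ju t) x ((EuclideanSpace.basisFun ι ℝ) l)⟫ =
      (𝓕 (fun ξ => (-(2 * π * I) * ((ξ l : ℝ) : ℂ)) * ((d.m ξ : ℂ) * d.V t ξ l)) x).re := by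
    intro l
    rw [EuclideanSpace.basisFun_apply, EuclideanSpace.inner_single_left, d.fderiv_ju_apply ht]
    simp only [conj_trivial, one_mul, EuclideanSpace.inner_single_right]
  simp_rw [hterm]
  rw [← Complex.re_sum]
  have hint : ∀ l ∈ (Finset.univ : Finset ι), Integrable fun ξ : EuclideanSpace ℝ ι =>
      (-(2 * π * I) * ((ξ l : ℝ) : ℂ)) * ((d.m ξ : ℂ) * d.V t ξ l) := fun l _ =>
    integrable_twoPiI_coord_mul (d.aesm_mV t l) (d.integrable_pow_mul_norm_mV 1 ht l) l
  rw [← fourier_finset_sum' Finset.univ hint]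
  have hzero : (fun ξ : EuclideanSpace ℝ ι => ∑ l, (-(2 * π * I) * ((ξ l : ℝ) : ℂ)) * ((d.m ξ : ℂ) * d.V t ξ l)) =
      fun _ => 0 := by
    funext ξ
    have := d.sum_mul_V t ξ
    calc ∑ l, (-(2 * π * I) * ((ξ l : ℝ) : ℂ)) * ((d.m ξ : ℂ) * d.V t ξ l)
        = -(2 * π * I) * (d.m ξ : ℂ) * ∑ l, ((ξ l : ℝ) : ℂ) * d.V t ξ l := by
          rw [Finset.mul_sum]; refine Finset.sum_congr rfl fun l _ => ?_; ring
      _ = 0 := by rw [this, mul_zero]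
  rw [hzero, fourier_zero', Complex.zero_re]

end Space

/-! ### The pressure gradient -/

/-- The integrable order `K₀ = card ι + 1`. [folklore] -/
def K₀ (_d : RegSetup ι) : ℕ := Fintype.card ι + 1

/-- `card ι < K₀`. [folklore] -/
theorem hK₀ : Fintype.card ι < d.K₀ := Nat.lt_succ_self _

/-- Measurability and every polynomial decay of the pressure symbol, uniformly on `[0, T]`
(the pressure symbol is the zeroth member of a Fourier family). [folklore] -/
theorem decay_q (K : ℕ) : ∃ B, ∀ t ∈ Icc 0 d.T, HasDecay K B (d.q t) ∧ AEStronglyMeasurable (d.q t) volume := by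
  obtain ⟨Q, hQ0, hQ⟩ := d.exists_presFamily 0
  obtain ⟨B, hB⟩ := hQ.decay 0 le_rfl K
  have hfun : ∀ t, Q 0 t = d.q t := fun t => funext (hQ0 t)
  exact ⟨B, fun t ht => ⟨hfun t ▸ hB t ht, hfun t ▸ hQ.meas 0 le_rfl t ht⟩⟩

/-- Measurability and every polynomial decay of the regularised nonlinearity components,
uniformly on `[0, T]`. [folklore] -/
theorem decay_N (K : ℕ) (l : ι) : ∃ B, ∀ t ∈ Icc 0 d.T,
    HasDecay K B (fun ξ => nonlin (vmul d.m (d.V t)) (d.V t) ξ l) ∧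
      AEStronglyMeasurable (fun ξ => nonlin (vmul d.m (d.V t)) (d.V t) ξ l) volume := by
  obtain ⟨N, hN0, hN⟩ := d.mild.exists_nonlinFamily d.hT 0 l
  obtain ⟨B, hB⟩ := hN.decay 0 le_rfl K
  have hfun : ∀ t, N 0 t = fun ξ => nonlin (vmul d.m (d.V t)) (d.V t) ξ l := fun t => funext (hN0 t)
  exact ⟨B, fun t ht => ⟨hfun t ▸ hB t ht, hfun t ▸ hN.meas 0 le_rfl t ht⟩⟩

section Pressure

variable {t : ℝ} (ht : t ∈ Icc 0 d.T)
include ht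

/-- The `x`-derivative of the complex pressure: `∂_h P = 𝓕 (-2πi⟪ξ,h⟫ q)`. [folklore] -/
theorem fderiv_P (x h : EuclideanSpace ℝ ι) :
    fderiv ℝ (d.P t) x h = 𝓕 (fun ξ => (-(2 * π * I) * (⟪ξ, h⟫ : ℂ)) * d.q t ξ) x := by
  obtain ⟨B, hB⟩ := d.decay_q (1 + d.K₀)
  exact fderiv_fourier_apply' d.hK₀ (hB t ht).1 (hB t ht).2 x h

/-- The complex pressure is differentiable in `x`. [folklore] -/
theorem differentiable_P : Differentiable ℝ (d.P t) := by
  obtain ⟨B, hB⟩ := d.decay_q (1 + d.K₀)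
  exact differentiable_fourier' d.hK₀ (hB t ht).1 (hB t ht).2

/-- **The pressure gradient**: `(∇p(t) x)_l = Re 𝓕 (-2πi ξ_l q)(x)`. [folklore] -/
theorem gradient_p_apply (x : EuclideanSpace ℝ ι) (l : ι) :
    gradient (d.p t) x l = (𝓕 (fun ξ => (-(2 * π * I) * ((ξ l : ℝ) : ℂ)) * d.q t ξ) x).re := by
  classical
  have h1 : gradient (d.p t) x l = fderiv ℝ (d.p t) x (EuclideanSpace.single l (1 : ℝ)) := by
    have : gradient (d.p t) x l = ⟪gradient (d.p t) x, EuclideanSpace.single l (1 : ℝ)⟫ := by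
      rw [EuclideanSpace.inner_single_right]; simp
    rw [this, gradient, InnerProductSpace.toDual_symm_apply]
  have h2 : HasFDerivAt (d.p t) (Complex.reCLM.comp (fderiv ℝ (d.P t) x)) x := by
    have : d.p t = Complex.reCLM ∘ d.P t := rfl
    rw [this]
    exact Complex.reCLM.hasFDerivAt.comp x ((d.differentiable_P ht) x).hasFDerivAt
  rw [h1, h2.fderiv, ContinuousLinearMap.comp_apply, Complex.reCLM_apply, d.fderiv_P ht]
  refine congrArg Complex.re (congrFun (fourier_congr' fun ξ => ?_) x)
  rw [EuclideanSpace.inner_single_right]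
  simp

end Pressure

/-! ### The time derivative -/

/-- **The time derivative of the velocity within `[0, T]`**:
`∂ₜ u(t, x)_l = Re 𝓕 (-c‖ξ‖² V_l − N(m•V, V)_l)(x)`. [folklore] -/
theorem hasDerivWithinAt_u (x : EuclideanSpace ℝ ι) {t : ℝ} (ht : t ∈ Icc 0 d.T) :
    HasDerivWithinAt (fun s => d.u s x)
      (reVec fun l => 𝓕 (fun ξ => -((d.c * ‖ξ‖ ^ 2 : ℝ) : ℂ) * d.V t ξ l -
        nonlin (vmul d.m (d.V t)) (d.V t) ξ l) x) (Icc 0 d.T) t := by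
  obtain ⟨W, hW0, hW⟩ := d.exists_family 1
  have hU : ∀ l, HasDerivWithinAt (fun s => d.U s x l)
      (𝓕 (fun ξ => -((d.c * ‖ξ‖ ^ 2 : ℝ) : ℂ) * d.V t ξ l - nonlin (vmul d.m (d.V t)) (d.V t) ξ l) x) (Icc 0 d.T) t := by
    intro l
    have h := hasDerivWithinAt_synth_time_dom (n := 0) d.hT (hW l) x ht
    have hsynth : (fun s => synth (fun k t ξ => W k t ξ l) (s, x)) = fun s => d.U s x l := by
      funext s; simp only [synth, hW0]; rfl
    rw [hsynth] at h
    have hW1 : ∀ ξ, W 1 t ξ l = -((d.c * ‖ξ‖ ^ 2 : ℝ) : ℂ) * d.V t ξ l - nonlin (vmul d.m (d.V t)) (d.V t) ξ l := by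
      intro ξ
      have h1 := (hW l).deriv 0 Nat.zero_lt_one ξ t ht
      simp only [hW0, zero_add] at h1
      have h2 := (d.mildK 0).hasDerivWithinAt_apply ξ ht l
      have hud : UniqueDiffWithinAt ℝ (Icc 0 d.T) t := uniqueDiffOn_Icc d.hT t ht
      rw [← h1.derivWithin hud, ← h2.derivWithin hud]
    have hval : synth (fun k => fun t ξ => W (k + 1) t ξ l) (t, x) =
        𝓕 (fun ξ => -((d.c * ‖ξ‖ ^ 2 : ℝ) : ℂ) * d.V t ξ l - nonlin (vmul d.m (d.V t)) (d.V t) ξ l) x := by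
      simp only [synth, zero_add]
      rw [show (fun ξ => W 1 t ξ l) = fun ξ => -((d.c * ‖ξ‖ ^ 2 : ℝ) : ℂ) * d.V t ξ l -
        nonlin (vmul d.m (d.V t)) (d.V t) ξ l from funext hW1]
    rw [hval] at h
    exact h
  have hvec : HasDerivWithinAt (fun s => d.U s x)
      (fun l => 𝓕 (fun ξ => -((d.c * ‖ξ‖ ^ 2 : ℝ) : ℂ) * d.V t ξ l - nonlin (vmul d.m (d.V t)) (d.V t) ξ l) x)
      (Icc 0 d.T) t := hasDerivWithinAt_pi.2 hU
  exact (reVec (ι := ι)).hasFDerivAt.comp_hasDerivWithinAt t hvec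

/-- The one-sided time derivative of `u`. [folklore] -/
theorem timeDerivWithin_u (x : EuclideanSpace ℝ ι) {t : ℝ} (ht : t ∈ Icc 0 d.T) :
    timeDerivWithin (Icc 0 d.T) d.u t x =
      reVec fun l => 𝓕 (fun ξ => -((d.c * ‖ξ‖ ^ 2 : ℝ) : ℂ) * d.V t ξ l -
        nonlin (vmul d.m (d.V t)) (d.V t) ξ l) x := by
  rw [timeDerivWithin_apply]
  exact (d.hasDerivWithinAt_u x ht).derivWithin (uniqueDiffOn_Icc d.hT t ht)

/-! ### The regularised convective term -/

/-- The transformed regularised convective term `G(t)(ξ)_l = ∑ⱼ ((m V_j) ⋆ (-2πi ζ_j V_l))(ξ)`. [folklore] -/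
def G (t : ℝ) (ξ : EuclideanSpace ℝ ι) (l : ι) : ℂ :=
  ∑ j, fconv (fun η => (d.m η : ℂ) * d.V t η j) (fun ζ => (-(2 * π * I) * ((ζ j : ℝ) : ℂ)) * d.V t ζ l) ξ

section Convect

variable {t : ℝ} (ht : t ∈ Icc 0 d.T)
include ht

/-- **The regularised convective term**: `((Ju·∇)u (t, x))_l = Re 𝓕 (G(t)_l)(x)` (reality of
`JU`, linearity and the convolution theorem). [folklore] -/
theorem convect_ju_u_apply (x : EuclideanSpace ℝ ι) (l : ι) :
    convect (d.ju t) (d.u t) x l = (𝓕 (fun ξ => d.G t ξ l) x).re := by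
  rw [convect_apply, d.fderiv_u_apply ht]
  congr 1
  have hexp : (fun ξ : EuclideanSpace ℝ ι => (-(2 * π * I) * (⟪ξ, d.ju t x⟫ : ℂ)) * d.V t ξ l) =
      fun ξ => ∑ j, d.JU t x j * ((-(2 * π * I) * ((ξ j : ℝ) : ℂ)) * d.V t ξ l) := by
    funext ξ
    rw [inner_eq_sum', Complex.ofReal_sum]
    simp_rw [Complex.ofReal_mul, d.ofReal_ju_apply]
    rw [Finset.mul_sum, Finset.sum_mul]
    refine Finset.sum_congr rfl fun j _ => ?_
    ring
  rw [hexp]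
  have hcoord : ∀ j, Integrable fun ξ : EuclideanSpace ℝ ι => (-(2 * π * I) * ((ξ j : ℝ) : ℂ)) * d.V t ξ l := fun j =>
    integrable_twoPiI_coord_mul (d.aesm_V t l) (d.integrable_pow_mul_norm 1 ht l) j
  have hint : ∀ j ∈ (Finset.univ : Finset ι), Integrable fun ξ : EuclideanSpace ℝ ι =>
      d.JU t x j * ((-(2 * π * I) * ((ξ j : ℝ) : ℂ)) * d.V t ξ l) := fun j _ => (hcoord j).const_mul _
  rw [fourier_finset_sum' Finset.univ hint]
  have hterm : ∀ j, 𝓕 (fun ξ : EuclideanSpace ℝ ι => d.JU t x j * ((-(2 * π * I) * ((ξ j : ℝ) : ℂ)) * d.V t ξ l)) x =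
      𝓕 (fconv (fun η => (d.m η : ℂ) * d.V t η j) (fun ζ => (-(2 * π * I) * ((ζ j : ℝ) : ℂ)) * d.V t ζ l)) x := by
    intro j
    rw [fourier_const_mul', JU, fourier_mul_fourier' (d.integrable_mV ht j) (hcoord j)]
  simp_rw [hterm]
  have hint2 : ∀ j ∈ (Finset.univ : Finset ι), Integrable
      (fconv (fun η => (d.m η : ℂ) * d.V t η j) (fun ζ => (-(2 * π * I) * ((ζ j : ℝ) : ℂ)) * d.V t ζ l)) :=
    fun j _ => integrable_fconv (d.integrable_mV ht j) (hcoord j)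
  rw [← fourier_finset_sum' Finset.univ hint2]
  rfl

/-- The convolution integrands of `G` are integrable (products of square-dominated functions). [folklore] -/
theorem integrable_G_pieces (ξ : EuclideanSpace ℝ ι) (j l : ι) :
    Integrable (fun η => (d.m η : ℂ) * d.V t η j * d.V t (ξ - η) l) ∧
      Integrable (fun η => (((η j : ℝ) : ℂ) * ((d.m η : ℂ) * d.V t η j)) * d.V t (ξ - η) l) := by
  obtain ⟨G₀, hG₀, hle₀⟩ := d.mild.dom_weight 0
  obtain ⟨G₁, hG₁, hle₁⟩ := d.mild.dom_weight 1
  have hV0 : ∀ η, ‖d.V t η l‖ ≤ G₀ η := fun η => le_trans (by simpa using norm_le_pi_norm (d.V t η) l) (hle₀ t ht η)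
  constructor
  · refine integrable_fconv_integrand_dom hG₀ hG₀ (fun η => ?_) hV0 (d.aesm_mV t j) (d.aesm_V t l) ξ
    rw [norm_mul, Complex.norm_real, Real.norm_eq_abs]
    calc |d.m η| * ‖d.V t η j‖ ≤ 1 * ‖d.V t η‖ :=
          mul_le_mul (d.hm.abs_le_one η) (norm_le_pi_norm _ j) (norm_nonneg _) zero_le_one
      _ ≤ G₀ η := by simpa using hle₀ t ht η
  · refine integrable_fconv_integrand_dom (f := fun η => ((η j : ℝ) : ℂ) * ((d.m η : ℂ) * d.V t η j)) hG₁ hG₀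
      (fun η => ?_) hV0 ((Continuous.aestronglyMeasurable (by fun_prop)).mul (d.aesm_mV t j)) (d.aesm_V t l) ξ
    rw [norm_mul, norm_mul, Complex.norm_real, Complex.norm_real, Real.norm_eq_abs, Real.norm_eq_abs]
    calc |η j| * (|d.m η| * ‖d.V t η j‖) ≤ ‖η‖ * (1 * ‖d.V t η‖) := by
          refine mul_le_mul (abs_apply_le_norm η j) (mul_le_mul (d.hm.abs_le_one η) (norm_le_pi_norm _ j)
            (norm_nonneg _) zero_le_one) (by positivity) (norm_nonneg _)
      _ ≤ (1 + ‖η‖) ^ 1 * ‖d.V t η‖ := by rw [one_mul, pow_one]; nlinarith [norm_nonneg η, norm_nonneg (d.V t η)]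
      _ ≤ G₁ η := hle₁ t ht η

/-- **Incompressibility inside the convolution**: `G_l = -2πi ∑ⱼ ξⱼ ((m V_j) ⋆ V_l)`
(`∑ⱼ ηⱼ m(η) Vⱼ(η) = 0` under the integral). [folklore] -/
theorem G_eq (ξ : EuclideanSpace ℝ ι) (l : ι) :
    d.G t ξ l = -(2 * π * I) * ∑ j, ((ξ j : ℝ) : ℂ) * fconv (fun η => (d.m η : ℂ) * d.V t η j) (fun η => d.V t η l) ξ := by
  have hI1 := fun j => (d.integrable_G_pieces ht ξ j l).1
  have hI2 := fun j => (d.integrable_G_pieces ht ξ j l).2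
  have hsplit : ∀ j, fconv (fun η => (d.m η : ℂ) * d.V t η j) (fun ζ => (-(2 * π * I) * ((ζ j : ℝ) : ℂ)) * d.V t ζ l) ξ =
      -(2 * π * I) * (((ξ j : ℝ) : ℂ) * fconv (fun η => (d.m η : ℂ) * d.V t η j) (fun η => d.V t η l) ξ) +
        (2 * π * I) * ∫ η, (((η j : ℝ) : ℂ) * ((d.m η : ℂ) * d.V t η j)) * d.V t (ξ - η) l := by
    intro j
    rw [fconv_apply, fconv_apply, ← integral_const_mul, ← integral_const_mul, ← integral_const_mul,
      ← integral_add ((hI1 j).const_mul _ |>.const_mul _) ((hI2 j).const_mul _)]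
    refine integral_congr_ae (Eventually.of_forall fun η => ?_)
    simp only [PiLp.sub_apply, Complex.ofReal_sub]
    ring
  unfold G
  simp_rw [hsplit]
  rw [Finset.sum_add_distrib, ← Finset.mul_sum, ← Finset.mul_sum]
  have hzero : ∑ j, ∫ η, (((η j : ℝ) : ℂ) * ((d.m η : ℂ) * d.V t η j)) * d.V t (ξ - η) l = 0 := by
    rw [← integral_finsetSum Finset.univ fun j _ => hI2 j]
    have : (fun η : EuclideanSpace ℝ ι => ∑ j, (((η j : ℝ) : ℂ) * ((d.m η : ℂ) * d.V t η j)) * d.V t (ξ - η) l) =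
        fun _ => 0 := by
      funext η
      have h0 := d.sum_mul_V t η
      have : ∑ j, (((η j : ℝ) : ℂ) * ((d.m η : ℂ) * d.V t η j)) = (d.m η : ℂ) * ∑ j, ((η j : ℝ) : ℂ) * d.V t η j := by
        rw [Finset.mul_sum]; refine Finset.sum_congr rfl fun j _ => ?_; ring
      rw [← Finset.sum_mul, this, h0, mul_zero, zero_mul]
    rw [this, integral_zero]
  rw [hzero, mul_zero, add_zero]

/-- **The Fourier-side momentum identity of the regularised system**:
`G_l − N(m•V, V)_l − 2πi ξ_l q = 0` pointwise. [folklore] -/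
theorem G_sub_nonlin_sub (ξ : EuclideanSpace ℝ ι) (l : ι) :
    d.G t ξ l - nonlin (vmul d.m (d.V t)) (d.V t) ξ l - (2 * π * I) * ((ξ l : ℝ) : ℂ) * d.q t ξ = 0 := by
  set C : ι → ι → ℂ := fun j k => fconv (fun η => (d.m η : ℂ) * d.V t η j) (fun η => d.V t η k) ξ with hC
  have hG : d.G t ξ l = -(2 * π * I) * ∑ j, ((ξ j : ℝ) : ℂ) * C j l := d.G_eq ht ξ l
  have hN : nonlin (vmul d.m (d.V t)) (d.V t) ξ l = -(2 * π * I) * ∑ j, ((ξ j : ℝ) : ℂ) * C j l +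
      (2 * π * I) * ((ξ l : ℝ) : ℂ) * ∑ j, ∑ k, ((ξ j * ξ k / ‖ξ‖ ^ 2 : ℝ) : ℂ) * C j k := by
    rw [nonlin_apply]
    change -(2 * π * I) * ∑ j, ∑ k, (lerayDerivSymbol j k l ξ : ℂ) * C j k = _
    have hinner : ∀ j, ∑ k, (lerayDerivSymbol j k l ξ : ℂ) * C j k =
        ((ξ j : ℝ) : ℂ) * C j l - ((ξ l : ℝ) : ℂ) * ∑ k, (((ξ j * ξ k / ‖ξ‖ ^ 2 : ℝ) : ℂ) * C j k) := by
      intro j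
      have hk : ∀ k, (lerayDerivSymbol j k l ξ : ℂ) * C j k =
          (if k = l then ((ξ j : ℝ) : ℂ) * C j k else 0) -
            ((ξ l : ℝ) : ℂ) * ((((ξ j * ξ k / ‖ξ‖ ^ 2 : ℝ)) : ℂ) * C j k) := by
        intro k
        rw [lerayDerivSymbol_apply]
        split_ifs with hkl
        · push_cast; ring
        · push_cast; ring
      simp_rw [hk]
      rw [Finset.sum_sub_distrib, Finset.sum_ite_eq' Finset.univ l, if_pos (Finset.mem_univ l), Finset.mul_sum]
    simp_rw [hinner]
    rw [Finset.sum_sub_distrib, mul_sub, Finset.mul_sum, Finset.mul_sum, Finset.mul_sum,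
      sub_eq_add_neg, ← Finset.sum_neg_distrib]
    congr 1
    refine Finset.sum_congr rfl fun j _ => ?_
    ring
  have hq : d.q t ξ = -∑ j, ∑ k, ((ξ j * ξ k / ‖ξ‖ ^ 2 : ℝ) : ℂ) * C j k := rfl
  rw [hG, hN, hq]
  ring

end Convect

/-! ### The regularised Navier–Stokes system -/

section Momentum

variable {t : ℝ} (ht : t ∈ Icc 0 d.T)
include ht

/-- Integrability of the Fourier-side time derivative `-c‖ξ‖² V_l − N_l`. [folklore] -/
theorem integrable_Dt (l : ι) : Integrable fun ξ : EuclideanSpace ℝ ι =>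
    -((d.c * ‖ξ‖ ^ 2 : ℝ) : ℂ) * d.V t ξ l - nonlin (vmul d.m (d.V t)) (d.V t) ξ l := by
  have h1 : Integrable fun ξ : EuclideanSpace ℝ ι => -((d.c * ‖ξ‖ ^ 2 : ℝ) : ℂ) * d.V t ξ l := by
    refine ((d.integrable_pow_mul_norm 2 ht l).const_mul d.c).mono'
      ((Continuous.aestronglyMeasurable (by fun_prop)).mul (d.aesm_V t l)) (Eventually.of_forall fun ξ => ?_)
    rw [norm_mul, norm_neg, Complex.norm_real, Real.norm_of_nonneg (by have := d.c_pos; positivity)]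
    ring_nf; rfl
  obtain ⟨B, hB⟩ := d.decay_N d.K₀ l
  exact h1.sub ((hB t ht).1.integrable (finrank_lt_of_card_lt d.hK₀) (hB t ht).2)

/-- Integrability of `G_l`. [folklore] -/
theorem integrable_G (l : ι) : Integrable fun ξ => d.G t ξ l := by
  refine integrable_finsetSum _ fun j _ => ?_
  exact integrable_fconv (d.integrable_mV ht j) (integrable_twoPiI_coord_mul (d.aesm_V t l) (d.integrable_pow_mul_norm 1 ht l) j)

/-- Integrability of `-4π²‖ξ‖² V_l`. [folklore] -/
theorem integrable_lap (l : ι) : Integrable fun ξ : EuclideanSpace ℝ ι => (-(4 * π ^ 2 * ‖ξ‖ ^ 2 : ℝ) : ℂ) * d.V t ξ l := by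
  refine ((d.integrable_pow_mul_norm 2 ht l).const_mul (4 * π ^ 2)).mono'
    ((Continuous.aestronglyMeasurable (by fun_prop)).mul (d.aesm_V t l)) (Eventually.of_forall fun ξ => ?_)
  rw [norm_mul, norm_neg, Complex.norm_real, Real.norm_of_nonneg (by positivity)]
  ring_nf; rfl

/-- Integrability of `-2πi ξ_l q`. [folklore] -/
theorem integrable_gradq (l : ι) : Integrable fun ξ : EuclideanSpace ℝ ι => (-(2 * π * I) * ((ξ l : ℝ) : ℂ)) * d.q t ξ := by
  obtain ⟨B, hB⟩ := d.decay_q (1 + d.K₀)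
  have h1 : HasDecay d.K₀ (2 * π * B) fun ξ : EuclideanSpace ℝ ι => (-(2 * π * I) * ((ξ l : ℝ) : ℂ)) * d.q t ξ := by
    have := (hB t ht).1
    rw [Nat.add_comm] at this
    refine this.mul_linear (by positivity) fun ξ => ?_
    rw [norm_mul, norm_neg, norm_mul, norm_mul, Complex.norm_two, Complex.norm_real, Complex.norm_I, mul_one,
      Real.norm_eq_abs, abs_of_pos Real.pi_pos, Complex.norm_real, Real.norm_eq_abs]
    exact mul_le_mul_of_nonneg_left (abs_apply_le_norm ξ l) (by positivity)
  exact h1.integrable (finrank_lt_of_card_lt d.hK₀) ((Continuous.aestronglyMeasurable (by fun_prop)).mul (hB t ht).2)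

/-- **The momentum equation of the regularised system** on `[0, T] × E`:
`∂ₜu + (Ju·∇)u = νΔu − ∇p` (componentwise: linearity of `𝓕` and `G − N − 2πi ξ q = 0`;
Leray 1934, (5.1) p. 237). [folklore] -/
theorem momentum_reg (x : EuclideanSpace ℝ ι) :
    timeDerivWithin (Icc 0 d.T) d.u t x + convect (d.ju t) (d.u t) x = d.ν • (Δ (d.u t)) x - gradient (d.p t) x := by
  ext l
  rw [PiLp.add_apply, PiLp.sub_apply, PiLp.smul_apply, d.timeDerivWithin_u x ht, reVec_apply,
    d.convect_ju_u_apply ht, d.laplacian_u_apply ht, d.gradient_p_apply ht, smul_eq_mul]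
  rw [← Complex.add_re, ← Complex.re_ofReal_mul, ← Complex.sub_re]
  congr 1
  rw [← fourier_add' (d.integrable_Dt ht l) (d.integrable_G ht l), ← fourier_const_mul' (d.ν : ℂ),
    ← fourier_sub' ((d.integrable_lap ht l).const_mul _) (d.integrable_gradq ht l)]
  refine congrFun (fourier_congr' fun ξ => ?_) x
  simp only [Pi.add_apply, Pi.sub_apply]
  have key := d.G_sub_nonlin_sub ht ξ l
  have hc : ((d.c * ‖ξ‖ ^ 2 : ℝ) : ℂ) = (d.ν : ℂ) * ((4 * π ^ 2 * ‖ξ‖ ^ 2 : ℝ) : ℂ) := by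
    unfold c; push_cast; ring
  rw [hc]
  linear_combination key

end Momentum

/-- **The fictitious force** `f = (u·∇)u − (Ju·∇)u`, which turns the regularised system into the
Navier–Stokes system with force `f` (so that the tree's calculus for classical solutions applies). [folklore] -/
def force (t : ℝ) (x : EuclideanSpace ℝ ι) : EuclideanSpace ℝ ι := convect (d.u t) (d.u t) x - convect (d.ju t) (d.u t) x

/-- **`(u, p)` solves the Navier–Stokes system with force `f = (u·∇)u − (Ju·∇)u` classically on
`[0, T] × E`**, i.e. the Leray-regularised system `∂ₜu + (Ju·∇)u = νΔu − ∇p`, `div u = 0`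
(Leray 1934, (5.1); Ożański–Pooley 2018, Thm. 6.33). [folklore] -/
theorem isClassicalNSSolutionOn : IsClassicalNSSolutionOn (Icc 0 d.T) d.ν d.force d.u d.p where
  smooth_velocity := d.smooth_u
  smooth_pressure := d.smooth_p
  momentum t ht x := by
    rw [force, ← d.momentum_reg ht x]
    abel
  divFree t ht := d.isDivFree_u ht

/-- The fictitious force is jointly smooth on `[0, T] × E`. [folklore] -/
theorem smooth_force : IsSmoothSpaceTimeOn (Icc 0 d.T) d.force :=
  IsSmoothSpaceTimeOn.sub (IsSmoothSpaceTimeOn.convect d.smooth_u d.smooth_u (uniqueDiffOn_Icc d.hT))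
    (IsSmoothSpaceTimeOn.convect d.smooth_ju d.smooth_u (uniqueDiffOn_Icc d.hT))

end RegSetup

end Literature.Analysis.FluidPDE.FourierNS

end
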